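import Mathlib.RingTheory.RegularLocalRing.Polynomial
import Mathlib.RingTheory.MvPolynomial.WeightedHomogeneous
import Mathlib.RingTheory.Polynomial.Quotient
import Mathlib.Algebra.Polynomial.Laurent
import Literature.AlgebraicGeometry.Resolution.CobordantBlowupFiltration
import Literature.AlgebraicGeometry.Resolution.BlowupChartRegular
import HarnessLib

/-!
# Cobordant blow-ups (Włodarczyk 2022), VI: the exceptional fibre ring and regularity of `B`

Topic: `Literature/AlgebraicGeometry/Resolution`. Continuation of `CobordantBlowupAlgebra.lean` /
`CobordantBlowupFiltration.lean`. J. Włodarczyk, *Functorial resolution by torus actions*,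
arXiv:2203.03090, §2.3.9: for a regular scheme `X` and a regular weighted centre
`𝒥 = (u₁^{1/w₁}, …, u_k^{1/w_k})` (the `uᵢ` part of a regular system of parameters, `wᵢ ≥ 1`) the
full cobordant blow-up `B = Spec_X 𝒪_X[t⁻¹, u₁ t^{w₁}, …, u_k t^{w_k}]` is "a regular closed subscheme
of `X × 𝔸ⁿ⁺¹`", locally `Spec 𝒪_X[s, u'] / (uᵢ − s^{wᵢ} uᵢ')`; in particular its exceptional fibre
`V(s)` is the weighted normal bundle `Spec (𝒪_X/(u))[u₁', …, u_k']` of the centre (§4.1). This is the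
fact that keeps the ambient scheme of the weighted resolution algorithm smooth after each cobordant
blow-up (route `ResolutionOfSingularities/WeightedInvariant`, items `DatumToEmbedded` stmt-0572 and
`DatumToResolution` stmt-8974: the datum's axioms only speak about SMOOTH ambient schemes, so `B₊`
must be shown regular, hence smooth over the perfect ground field, `SmoothOfRegularPerfectField.lean`).

PROVED here, in the affine model `𝒪_B = cobordantAlgebra u w ⊆ A[t, t⁻¹]` over any commutative ring:

* `cobordantAlgebra.mem_span_s_iff` — the exceptional ideal `(s) = t⁻¹ 𝒪_B` is graded:
  `x ∈ (s) ↔ coeffₙ x ∈ 𝒥ₙ₊₁` for all `n ≥ 0` (`𝒥ₙ = (u^α : Σ wᵢαᵢ ≥ n)`, `weightedFiltration`);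
* `cobordantAlgebra.coeff_aeval_u'` — `P(u₁ t^{w₁}, …, u_k t^{w_k})` has `tⁿ`-coefficient `Pₙ(u)`,
  `Pₙ` the weight-`n` component of `P ∈ A[X]` (`MvPolynomial.weightedHomogeneousComponent`);
* `cobordantAlgebra.aeval_u'_mem_span_s_iff_coeff_mem` — under **weighted quasi-regularity** of `u`
  (hypothesis `hwqr`: a `w`-form `P` of weight `n` with `P(u) ∈ 𝒥ₙ₊₁` has coefficients in `(u)`;
  supplied for parts of regular systems of parameters by `WeightedMonomialQuasiRegular.lean`) the kernel
  of `A[X] → 𝒪_B/(s)`, `Xᵢ ↦ uᵢ'`, is `(u) A[X]`; with `mk_comp_aeval_u'_surjective`: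
* `cobordantAlgebra.nonempty_quotient_span_s_equiv` — **`𝒪_B/(s) ≅ (A/(u))[X₁, …, X_k]`**;
* `cobordantAlgebra.isNoetherianRing`, and
* `cobordantAlgebra.isRegularRing` — **`𝒪_B` is a regular ring** when `A` and `A/(u)` are regular
  rings, the weights are positive and `u` is weighted quasi-regular: `s` is a non-zero-divisor,
  `𝒪_B[1/s] = A[t, t⁻¹]` (`isLocalization_away_s`) is a localisation of the regular ring `A[t]`, and
  `𝒪_B/(s)` is a polynomial ring over the regular ring `A/(u)`; conclude prime by prime with
  `isRegularLocalRing_localization_of_mem_of_quotient` / `…_of_not_mem_of_away`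
  (`BlowupChartRegular.lean`, the same route as Liu Thm. 8.1.19 (a) for ordinary blow-ups).

## Sources

* J. Włodarczyk, arXiv:2203.03090 (July 2025 version), §2.3.9, Rem. 2.3.10, §4.1, Lemma 4.4.2.
  [Wlodarczyk2022]
* Q. Liu, *Algebraic Geometry and Arithmetic Curves*, OUP 2002, Thm. 8.1.19 (a) (the unweighted case).
  [Liu2002]
-/

noncomputable section

namespace Literature.AlgebraicGeometry.Resolution

open scoped LaurentPolynomial
open LaurentPolynomial MvPolynomial

universe u v

section ExceptionalFibre

variable {A : Type u} [CommRing A] {ι : Type v} (u : ι → A) (w : ι → ℕ)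

namespace cobordantAlgebra

/-- The coefficients of an element of `𝒪_B = ⊕ₙ 𝒥ₙ tⁿ` lie in the weighted filtration: the
coefficient of `tⁿ`, `n ≥ 0`, lies in `𝒥ₙ = (u^α : Σ wᵢ αᵢ ≥ n)`. [cite: Wlodarczyk2022, Lemma 2.1.8] -/
theorem coeff_mem_weightedFiltration (x : cobordantAlgebra u w) (n : ℕ) :
    (x : A[T;T⁻¹]).coeff (n : ℤ) ∈ (weightedFiltration u w).ideal n := by
  have hx : (x : A[T;T⁻¹]) ∈ (weightedFiltration u w).extendedRees := by
    rw [← cobordantAlgebra_eq_extendedRees]; exact x.2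
  exact ((weightedFiltration u w).mem_extendedRees_iff.mp hx) n

/-- An element of `A[t, t⁻¹]` all of whose non-negative coefficients lie in the weighted filtration
belongs to `𝒪_B`. [cite: Wlodarczyk2022, Lemma 2.1.8] -/
theorem mem_of_coeff_mem {p : A[T;T⁻¹]} (hp : ∀ n : ℕ, p.coeff (n : ℤ) ∈ (weightedFiltration u w).ideal n) :
    p ∈ cobordantAlgebra u w := by
  rw [cobordantAlgebra_eq_extendedRees]
  exact (weightedFiltration u w).mem_extendedRees_iff.mpr hp

/-- **The exceptional ideal is graded**: `x ∈ (s) = t⁻¹ 𝒪_B` iff the coefficient of `tⁿ` of `x`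
lies in `𝒥ₙ₊₁` for every `n ≥ 0` (since `(t⁻¹ 𝒪_B)ₙ tⁿ = 𝒥ₙ₊₁ tⁿ`). [folklore] -/
theorem mem_span_s_iff (x : cobordantAlgebra u w) :
    x ∈ Ideal.span {s u w} ↔ ∀ n : ℕ, (x : A[T;T⁻¹]).coeff (n : ℤ) ∈ (weightedFiltration u w).ideal (n + 1) := by
  constructor
  · intro hx n
    obtain ⟨y, rfl⟩ := Ideal.mem_span_singleton'.mp hx
    have e : ((y * s u w : cobordantAlgebra u w) : A[T;T⁻¹]).coeff (n : ℤ) = (y : A[T;T⁻¹]).coeff ((n + 1 : ℕ) : ℤ) := by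
      rw [MulMemClass.coe_mul, coe_s]
      have : (T (-1) : A[T;T⁻¹]) = AddMonoidAlgebra.single (-1 : ℤ) (1 : A) := rfl
      rw [this, AddMonoidAlgebra.coeff_mul_single_apply, mul_one]
      rfl
    rw [e]
    exact coeff_mem_weightedFiltration u w y (n + 1)
  · intro hx
    -- `y := x · t` lies in `𝒪_B` and `x = s y`
    have hy : (x : A[T;T⁻¹]) * T 1 ∈ cobordantAlgebra u w := by
      refine mem_of_coeff_mem u w fun n => ?_
      have : (T 1 : A[T;T⁻¹]) = AddMonoidAlgebra.single (1 : ℤ) (1 : A) := rfl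
      rw [this, AddMonoidAlgebra.coeff_mul_single_apply, mul_one]
      rcases Nat.eq_zero_or_pos n with rfl | hn
      · rw [(weightedFiltration u w).ideal_zero]; trivial
      · obtain ⟨m, rfl⟩ : ∃ m, n = m + 1 := ⟨n - 1, by omega⟩
        have e : ((m + 1 : ℕ) : ℤ) + -1 = (m : ℤ) := by push_cast; ring
        rw [e]
        exact hx m
    refine Ideal.mem_span_singleton'.mpr ⟨⟨_, hy⟩, Subtype.ext ?_⟩
    rw [MulMemClass.coe_mul, coe_s, mul_assoc, ← T_add]
    simp

/-- **The controlled transform of a weighted form**: for a `w`-homogeneous polynomial `P` of weight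
`n`, `P(u₁ t^{w₁}, …, u_k t^{w_k}) = P(u) · tⁿ` in `A[t, t⁻¹]`; in general the coefficient of `tⁿ`
of `P(u')` is the value at `u` of the weight-`n` component of `P`. [cite: Wlodarczyk2022, §4.4] -/
theorem coeff_aeval_u' [DecidableEq ι] (P : MvPolynomial ι A) (n : ℕ) :
    ((MvPolynomial.aeval (u' u w) P : cobordantAlgebra u w) : A[T;T⁻¹]).coeff (n : ℤ) =
      MvPolynomial.eval u (weightedHomogeneousComponent w n P) := by
  classical
  induction P using MvPolynomial.induction_on' with
  | monomial d c =>
    rw [MvPolynomial.aeval_monomial, MulMemClass.coe_mul, coe_prod_u'_pow, coe_algebraMap, ← mul_assoc,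
      ← map_mul, ← single_eq_C_mul_T, AddMonoidAlgebra.coeff_single, Finsupp.single_apply,
      weightedHomogeneousComponent_apply]
    by_cases hc : c = 0
    · subst hc; simp
    rw [MvPolynomial.support_monomial, if_neg hc, Finset.filter_singleton]
    by_cases hd : Finsupp.weight w d = n
    · rw [if_pos hd, Finset.sum_singleton, MvPolynomial.coeff_monomial, if_pos rfl,
        MvPolynomial.eval_monomial, if_pos (by exact_mod_cast hd)]
    · rw [if_neg hd, Finset.sum_empty, map_zero, if_neg (by exact_mod_cast hd)]
  | add p q hp hq =>
    rw [map_add, AddMemClass.coe_add, AddMonoidAlgebra.coeff_add, Finsupp.add_apply, hp, hq, map_add,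
      map_add]

/-- `P(u') ∈ (s)` iff every weighted component `Pₙ` of `P` has `Pₙ(u) ∈ 𝒥ₙ₊₁`. [folklore] -/
theorem aeval_u'_mem_span_s_iff [DecidableEq ι] (P : MvPolynomial ι A) :
    MvPolynomial.aeval (u' u w) P ∈ Ideal.span {s u w} ↔
      ∀ n : ℕ, MvPolynomial.eval u (weightedHomogeneousComponent w n P) ∈
        (weightedFiltration u w).ideal (n + 1) := by
  rw [mem_span_s_iff]
  simp only [coeff_aeval_u']

/-- The images `uᵢ = s^{wᵢ} uᵢ'` of the parameters lie in `(s)` when the weights are positive, hence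
so does the image of `(u) · A[X]`. [folklore] -/
theorem aeval_u'_mem_span_s_of_mem (hw : ∀ i, 0 < w i) {P : MvPolynomial ι A}
    (hP : P ∈ Ideal.map (MvPolynomial.C : A →+* MvPolynomial ι A) (Ideal.span (Set.range u))) :
    MvPolynomial.aeval (u' u w) P ∈ Ideal.span {s u w} := by
  rw [Ideal.map_span] at hP
  refine Submodule.span_induction (p := fun P _ => MvPolynomial.aeval (u' u w) P ∈ Ideal.span {s u w})
    ?_ ?_ ?_ ?_ hP
  · rintro _ ⟨_, ⟨i, rfl⟩, rfl⟩
    rw [MvPolynomial.algHom_C, algebraMap_u]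
    obtain ⟨m, hm⟩ := Nat.exists_eq_add_of_le' (hw i)
    rw [hm, pow_succ, mul_assoc, mul_comm (s u w ^ m), mul_assoc]
    exact Ideal.mul_mem_right _ _ (Ideal.mem_span_singleton_self _)
  · rw [map_zero]; exact Ideal.zero_mem _
  · intro a b _ _ ha hb
    rw [map_add]; exact Ideal.add_mem _ ha hb
  · intro a b _ hb
    rw [smul_eq_mul, map_mul]; exact Ideal.mul_mem_left _ _ hb

/-- **The kernel of `A[X] → 𝒪_B/(s)`, `Xᵢ ↦ uᵢ'`, is `(u) · A[X]`** under weighted quasi-regularity of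
`u` (hypothesis `hwqr`, see `WeightedMonomialQuasiRegular.lean`): `P(u') ∈ (s)` iff all coefficients
of `P` lie in `(u)`. [cite: Wlodarczyk2022, §2.3.9] -/
theorem aeval_u'_mem_span_s_iff_coeff_mem [DecidableEq ι] (hw : ∀ i, 0 < w i)
    (hwqr : ∀ (n : ℕ) (P : MvPolynomial ι A), P.IsWeightedHomogeneous w n →
      MvPolynomial.eval u P ∈ (weightedFiltration u w).ideal (n + 1) →
        ∀ β, P.coeff β ∈ Ideal.span (Set.range u))
    (P : MvPolynomial ι A) :
    MvPolynomial.aeval (u' u w) P ∈ Ideal.span {s u w} ↔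
      P ∈ Ideal.map (MvPolynomial.C : A →+* MvPolynomial ι A) (Ideal.span (Set.range u)) := by
  refine ⟨fun h => ?_, aeval_u'_mem_span_s_of_mem u w hw⟩
  rw [MvPolynomial.mem_map_C_iff]
  intro β
  rw [aeval_u'_mem_span_s_iff] at h
  have := hwqr (Finsupp.weight w β) _ (weightedHomogeneousComponent_isWeightedHomogeneous _ P)
    (h _) β
  rwa [coeff_weightedHomogeneousComponent, if_pos rfl] at this

/-- The map `A[X] → 𝒪_B/(s)`, `Xᵢ ↦ uᵢ'`, is surjective: `𝒪_B` is generated over `A` by `s` and the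
`uᵢ'`. [folklore] -/
theorem mk_comp_aeval_u'_surjective :
    Function.Surjective ((Ideal.Quotient.mk (Ideal.span {s u w})).comp
      (MvPolynomial.aeval (u' u w) : MvPolynomial ι A →ₐ[A] cobordantAlgebra u w).toRingHom) := by
  -- compare with the presentation `A[X_none, X_some i] → 𝒪_B` through `X_none ↦ 0`
  let θ : MvPolynomial (Option ι) A →ₐ[A] MvPolynomial ι A :=
    MvPolynomial.aeval fun o => o.elim 0 MvPolynomial.X
  have hcomp : ((Ideal.Quotient.mkₐ A (Ideal.span {s u w})).comp (presentation u w)) =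
      ((Ideal.Quotient.mkₐ A (Ideal.span {s u w})).comp (MvPolynomial.aeval (u' u w))).comp θ := by
    refine MvPolynomial.algHom_ext fun o => ?_
    cases o with
    | none =>
      simp only [AlgHom.comp_apply, presentation_X_none, Ideal.Quotient.mkₐ_eq_mk, θ,
        MvPolynomial.aeval_X, Option.elim, map_zero]
      exact Ideal.Quotient.eq_zero_iff_mem.mpr (Ideal.mem_span_singleton_self _)
    | some i =>
      simp only [AlgHom.comp_apply, presentation_X_some, Ideal.Quotient.mkₐ_eq_mk, θ,
        MvPolynomial.aeval_X, Option.elim]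
  intro y
  obtain ⟨x, rfl⟩ := Ideal.Quotient.mk_surjective y
  obtain ⟨P, rfl⟩ := presentation_surjective u w x
  refine ⟨θ P, ?_⟩
  have := congrArg (fun f => f P) hcomp
  simp only [AlgHom.comp_apply, Ideal.Quotient.mkₐ_eq_mk] at this
  exact this.symm

/-- **The exceptional fibre ring of the full cobordant blow-up**: under weighted quasi-regularity of
the centre, `𝒪_B/(s) = A[t⁻¹, uᵢ t^{wᵢ}]/(t⁻¹) ≅ (A/(u))[X₁, …, X_k]` — the coordinate ring of the
weighted normal bundle `N_𝒥(X) = Spec gr_𝒥(𝒪_X)` of the centre (Włodarczyk, §2.3.9: `B` is locally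
`Spec 𝒪_X[s, u'] / (uᵢ − s^{wᵢ} uᵢ')`, so `V(s) = Spec (𝒪_X/(u))[u']`; §4.1). [cite: Wlodarczyk2022, §2.3.9] -/
theorem nonempty_quotient_span_s_equiv [DecidableEq ι] (hw : ∀ i, 0 < w i)
    (hwqr : ∀ (n : ℕ) (P : MvPolynomial ι A), P.IsWeightedHomogeneous w n →
      MvPolynomial.eval u P ∈ (weightedFiltration u w).ideal (n + 1) →
        ∀ β, P.coeff β ∈ Ideal.span (Set.range u)) :
    Nonempty ((cobordantAlgebra u w ⧸ Ideal.span {s u w}) ≃+*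
      MvPolynomial ι (A ⧸ Ideal.span (Set.range u))) := by
  set ψ := (Ideal.Quotient.mk (Ideal.span {s u w})).comp
    (MvPolynomial.aeval (u' u w) : MvPolynomial ι A →ₐ[A] cobordantAlgebra u w).toRingHom with hψ
  have hker : RingHom.ker ψ = Ideal.map (MvPolynomial.C : A →+* MvPolynomial ι A) (Ideal.span (Set.range u)) := by
    ext P
    rw [RingHom.mem_ker, hψ, RingHom.comp_apply, Ideal.Quotient.eq_zero_iff_mem]
    exact aeval_u'_mem_span_s_iff_coeff_mem u w hw hwqr P
  have e1 := RingHom.quotientKerEquivOfSurjective (mk_comp_aeval_u'_surjective u w)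
  have e2 := Ideal.quotEquivOfEq hker
  have e3 := (MvPolynomial.quotientEquivQuotientMvPolynomial (Ideal.span (Set.range u)) :
    MvPolynomial ι (A ⧸ Ideal.span (Set.range u)) ≃ₐ[A] _).toRingEquiv
  exact ⟨(e1.symm.trans e2).trans e3.symm⟩

/-- `𝒪_B = A[t⁻¹, uᵢ t^{wᵢ}]` is Noetherian for `A` Noetherian and finitely many parameters (a
quotient of `A[s, u']`). [folklore] -/
theorem isNoetherianRing [IsNoetherianRing A] [Finite ι] : IsNoetherianRing (cobordantAlgebra u w) :=
  isNoetherianRing_of_surjective _ _ (presentation u w).toRingHom (presentation_surjective u w)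

/-- **The full cobordant blow-up of a regular ring at a weighted centre is regular** (Włodarczyk,
arXiv:2203.03090, §2.3.9: "`B` is a regular closed subscheme of `X × 𝔸ⁿ⁺¹`"), ring form: if `A` is
a regular ring, the weights are positive, the centre `A/(u)` is a regular ring and `u` is weighted
quasi-regular (all three hold when the `uᵢ` are part of a regular system of parameters at the points
of `V(u)`, `WeightedMonomialQuasiRegular.lean`), then `𝒪_B = A[t⁻¹, uᵢ t^{wᵢ}]` is a regular ring.
Proof: `s = t⁻¹` is a non-zero-divisor with `𝒪_B[1/s] = A[t, t⁻¹]` a localisation of the regular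
ring `A[t]`, and `𝒪_B/(s) ≅ (A/(u))[X]` is regular; regularity at a prime `Q` follows in both cases
`s ∉ Q`, `s ∈ Q` (`BlowupChartRegular.lean`). [cite: Wlodarczyk2022, §2.3.9] -/
theorem isRegularRing [IsRegularRing A] [Finite ι] (hw : ∀ i, 0 < w i)
    (hwqr : ∀ (n : ℕ) (P : MvPolynomial ι A), P.IsWeightedHomogeneous w n →
      MvPolynomial.eval u P ∈ (weightedFiltration u w).ideal (n + 1) →
        ∀ β, P.coeff β ∈ Ideal.span (Set.range u))
    [IsRegularRing (A ⧸ Ideal.span (Set.range u))] : IsRegularRing (cobordantAlgebra u w) := by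
  classical
  haveI : IsNoetherianRing (cobordantAlgebra u w) := isNoetherianRing u w
  haveI : IsRegularRing (cobordantAlgebra u w ⧸ Ideal.span {s u w}) := by
    obtain ⟨e⟩ := nonempty_quotient_span_s_equiv u w hw hwqr
    exact IsRegularRing.of_ringEquiv e.symm
  rw [isRegularRing_iff]
  intro Q hQ
  by_cases h : s u w ∈ Q
  · exact isRegularLocalRing_localization_of_mem_of_quotient (s_mem_nonZeroDivisors u w) Q h
  · haveI := isLocalization_away_s u w
    exact isRegularLocalRing_localization_of_not_mem_of_away (R := Polynomial A)
      (Submonoid.powers (Polynomial.X : Polynomial A)) (T := A[T;T⁻¹]) (s u w) Q h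

end cobordantAlgebra

end ExceptionalFibre

end Literature.AlgebraicGeometry.Resolution

end
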